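import Summits.CriticalPhenomena.CardyFormulaZ2.Theorems.StripClusterRates.Negative.SubmultiplicativeOne

/-!
# `StripClusterRates` (stmt-CriticalPhenomena-13878), line `two-cluster-rate-is-stationary-gap`:
# Fekete-type finite-length UPPER bound on a rate from quasi-multiplicativity with a gap

Generic real-analysis step (stub `qm_rate_le_finite`) of the reduction of the two-cluster Kac
prediction to two-cluster quasi-multiplicativity `QM₂`: if a positive sequence `q` is
quasi-multiplicative with a constant `C > 0` and a gap `K`,
`q m₁ · q m₂ ≤ C · q (m₁ + m₂ + K)`, then every limit `γ` of `-log (q m) / m` obeys the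
finite-length upper bound `γ ≤ (-log (q m) + log C) / (m + K)` for every `m ≥ 1`
(applied with `q m = p₂(m,n)` at fixed `n` and `K = k·n`).

Proof (mirror image of `rateOne_ge_finite` in `StripClusterRates.Negative.SubmultiplicativeOne`,
which treats SUB-multiplicativity and LOWER bounds): iterate the hypothesis along the blocks
`M j = (j+1) m + j K` (`qm1_pow_le : q m ^ (j+1) ≤ C ^ j · q (M j)`), take logarithms
(`qm1_neg_log_le : -log q (M j) ≤ (j+1) · (-log q m) + j · log C`), divide by `M j`, rewrite the
right-hand side as `ℓ + (ℓ K - log C) / M j` with `ℓ = (-log q m + log C)/(m + K)`, and let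
`j → ∞` along the subsequence `M j → ∞`.
-/

noncomputable section

open MeasureTheory Filter Topology
open Literature.Probability.LatticeModels Literature.Probability.Percolation

namespace Summit.CriticalPhenomena.CardyFormulaZ2.Cruxes.StripClusterRates.TwoClusterRateIsStationaryGap

/-- Iterated quasi-multiplicativity with a gap: `q m ^ (j+1) ≤ C ^ j · q ((j+1) m + j K)`.
[folklore] -/
theorem qm1_pow_le {q : ℕ → ℝ} {C : ℝ} {K : ℕ} (hC : 0 < C) (hq : ∀ m : ℕ, 0 < q m)
    (hQ : ∀ m₁ m₂ : ℕ, q m₁ * q m₂ ≤ C * q (m₁ + m₂ + K)) (m j : ℕ) :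
    q m ^ (j + 1) ≤ C ^ j * q ((j + 1) * m + j * K) := by
  induction j with
  | zero => simp
  | succ j ih =>
    have h := hQ ((j + 1) * m + j * K) m
    have heq : (j + 1) * m + j * K + m + K = (j + 1 + 1) * m + (j + 1) * K := by ring
    rw [heq] at h
    calc q m ^ (j + 1 + 1) = q m ^ (j + 1) * q m := pow_succ _ _
      _ ≤ C ^ j * q ((j + 1) * m + j * K) * q m := mul_le_mul_of_nonneg_right ih (hq m).le
      _ = C ^ j * (q ((j + 1) * m + j * K) * q m) := mul_assoc _ _ _
      _ ≤ C ^ j * (C * q ((j + 1 + 1) * m + (j + 1) * K)) :=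
          mul_le_mul_of_nonneg_left h (pow_nonneg hC.le j)
      _ = C ^ (j + 1) * q ((j + 1 + 1) * m + (j + 1) * K) := by ring

/-- Logarithmic form of the iterated bound:
`-log q ((j+1) m + j K) ≤ (j+1) · (-log q m) + j · log C`. [folklore] -/
theorem qm1_neg_log_le {q : ℕ → ℝ} {C : ℝ} {K : ℕ} (hC : 0 < C) (hq : ∀ m : ℕ, 0 < q m)
    (hQ : ∀ m₁ m₂ : ℕ, q m₁ * q m₂ ≤ C * q (m₁ + m₂ + K)) (m j : ℕ) :
    -Real.log (q ((j + 1) * m + j * K)) ≤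
      ((j : ℝ) + 1) * -Real.log (q m) + j * Real.log C := by
  have h := Real.log_le_log (pow_pos (hq m) (j + 1)) (qm1_pow_le hC hq hQ m j)
  rw [Real.log_pow, Real.log_mul (pow_pos hC j).ne' (hq _).ne', Real.log_pow] at h
  push_cast at h
  linarith

/-- The block subsequence `j ↦ (j+1) m + j K` tends to infinity when `1 ≤ m`. [folklore] -/
theorem qm1_tendsto_blocks {m : ℕ} (hm : 1 ≤ m) (K : ℕ) :
    Tendsto (fun j : ℕ ↦ (j + 1) * m + j * K) atTop atTop := by
  refine tendsto_atTop_mono (fun j ↦ ?_) tendsto_id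
  simp only [id]
  nlinarith

/-- **Fekete-type finite-length upper bound on a rate from quasi-multiplicativity with a gap.**
If `q > 0` satisfies `q m₁ · q m₂ ≤ C · q (m₁ + m₂ + K)` with `C > 0`, then every limit `γ` of
`-log (q m) / m` satisfies `γ ≤ (-log (q m) + log C) / (m + K)` for every `m ≥ 1`. [folklore] -/
theorem qm_rate_le_finite : ∀ (q : ℕ → ℝ) (C : ℝ) (K : ℕ), 0 < C → (∀ m : ℕ, 0 < q m) →
    (∀ m₁ m₂ : ℕ, q m₁ * q m₂ ≤ C * q (m₁ + m₂ + K)) → ∀ γ : ℝ,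
    Tendsto (fun m : ℕ ↦ -Real.log (q m) / (m : ℝ)) atTop (𝓝 γ) → ∀ m : ℕ, 1 ≤ m →
    γ ≤ (-Real.log (q m) + Real.log C) / ((m : ℝ) + K) := by
  intro q C K hC hq hQ γ hγ m hm
  set a : ℝ := -Real.log (q m) with ha
  set b : ℝ := Real.log C with hb
  set ℓ : ℝ := (a + b) / ((m : ℝ) + (K : ℝ)) with hℓ
  have hmK : (0 : ℝ) < (m : ℝ) + K := by
    have h1 : (1 : ℝ) ≤ m := by exact_mod_cast hm
    have h2 : (0 : ℝ) ≤ K := Nat.cast_nonneg K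
    linarith
  have hℓ' : ℓ * ((m : ℝ) + K) = a + b := div_mul_cancel₀ (a + b) hmK.ne'
  -- the block subsequence `M j = (j+1) m + j K`, as naturals and as reals
  have hM := qm1_tendsto_blocks hm K
  have hMR : Tendsto (fun j : ℕ ↦ (((j + 1) * m + j * K : ℕ) : ℝ)) atTop atTop :=
    tendsto_natCast_atTop_atTop.comp hM
  -- along the blocks the rate sequence tends to `γ`
  have hf : Tendsto (fun j : ℕ ↦
      -Real.log (q ((j + 1) * m + j * K)) / (((j + 1) * m + j * K : ℕ) : ℝ)) atTop (𝓝 γ) :=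
    hγ.comp hM
  -- the comparison sequence tends to `ℓ`
  have hg : Tendsto (fun j : ℕ ↦ ℓ + (ℓ * K - b) / (((j + 1) * m + j * K : ℕ) : ℝ))
      atTop (𝓝 ℓ) := by
    have h1 : Tendsto (fun _ : ℕ ↦ ℓ) atTop (𝓝 ℓ) := tendsto_const_nhds
    have h2 : Tendsto (fun _ : ℕ ↦ ℓ * K - b) atTop (𝓝 (ℓ * K - b)) := tendsto_const_nhds
    have h := h1.add (h2.div_atTop hMR)
    rw [add_zero] at h
    exact h
  refine le_of_tendsto_of_tendsto' hf hg fun j ↦ ?_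
  have hMpos : (0 : ℝ) < (((j + 1) * m + j * K : ℕ) : ℝ) := Nat.cast_pos.mpr (by nlinarith)
  have hlog : -Real.log (q ((j + 1) * m + j * K)) ≤ ((j : ℝ) + 1) * a + j * b :=
    qm1_neg_log_le hC hq hQ m j
  have key : ((j : ℝ) + 1) * a + j * b =
      ℓ * (((j + 1) * m + j * K : ℕ) : ℝ) + (ℓ * K - b) := by
    push_cast
    linear_combination (-((j : ℝ) + 1)) * hℓ'
  calc -Real.log (q ((j + 1) * m + j * K)) / (((j + 1) * m + j * K : ℕ) : ℝ)
      ≤ (((j : ℝ) + 1) * a + j * b) / (((j + 1) * m + j * K : ℕ) : ℝ) :=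
        div_le_div_of_nonneg_right hlog hMpos.le
    _ = ℓ + (ℓ * K - b) / (((j + 1) * m + j * K : ℕ) : ℝ) := by
        rw [key, add_div, mul_div_assoc, div_self hMpos.ne', mul_one]

end Summit.CriticalPhenomena.CardyFormulaZ2.Cruxes.StripClusterRates.TwoClusterRateIsStationaryGap

end
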